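import Summits.BirchSwinnertonDyer.BirchSwinnertonDyer.Theorems.PrintX11aUpperNonSurjFiveTamagawaDivisibility
import Summits.BirchSwinnertonDyer.BirchSwinnertonDyer.Theorems.PrintX11aNonSurjMuAnHardDefs
import HarnessLib

/-!
# Route `PrintX11a`, crux U5 = `Theses.PrintX11a.UpperNonSurjFive` (item stmt-BirchSwinnertonDyer-20614), line of record «gl1cartan5»
# (rev 10): the SHALLOW sector «`p` non-split, `Ш(E)[p] = 0`, `ord_p ∏ c_ℓ ≤ 1`» is CLOSED modulo the nine print facts, and the open part
# of U5 is re-cut into THREE cores keyed to the three terms of the BSD quotient (route-file-free module; the BY-NAME glue is its sequel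
# `Theorems/PrintX11aUpperNonSurjFiveThreeCores.lean`)

Cell `bsd-print-x11a`, LEAD `cruxlead-stmt-BirchSwinnertonDyer-20614` g5 (`--supports stmt-BirchSwinnertonDyer-20614 --as helper`).  THEOREMS ONLY: no
definition, no named fact minted, no `sorry`; every theorem is CONDITIONAL on named published facts displayed as hypotheses and ∕ or on the open
residual statements; item 20614 is NOT closed by this file and nothing is asserted about any curve.  Sequel of
`Theorems/PrintX11aUpperNonSurjFiveTamagawaDivisibility.lean` (p674376); this module does not import the route file.

THE POINT.  Rev 9 of the record cut the open part of U5 into two NON-UNIT cores: R′♭ (no split multiplicative prime, `Ш(E)[p] ≠ 0`,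
`ord_p (L(E,1)/Ω_E) ≠ 0`) and R₁′♭ (some split multiplicative prime, hard locus).  The Tamagawa divisibility of p674376 — at a NON-split `p`
with a split multiplicative `ℓ`, `ord_p (L(E,1)/Ω_E) ≥ 1` modulo the nine facts — has a consequence for R₁′♭ not drawn there: with
`#Ш_an = (L/Ω)·#E(ℚ)²/∏ c` (Gross–Zagier–Kolyvagin at analytic rank `0`) and `p ∤ #E(ℚ)` (irreducible `E[p]`),
`ord_p #Ш_an = ord_p (L(E,1)/Ω_E) − ord_p ∏ c_ℓ` (§1, any X11a pair with `5 ≤ p`), so at a non-split `p` with `ord_p ∏ c_ℓ ≤ 1` the analytic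
order is `p`-INTEGRAL (depth `0`: Wuthrich–Mazur integrality of `L/Ω`; depth `1`: a split multiplicative `ℓ` exists, so `ord_p (L/Ω) ≥ 1`), and the
tree door `ClassX11a.missingUpperBoundAt_of_noPTorsion` serves `MissingUpperBoundAt W p` wherever `Ш(E)[p] = 0`:

* §2 `GL1Cartan.upperNonSurjFive_on_shallowSector_of_nineFacts` — **the SHALLOW sector** «X11a, `¬ Surj`, `5 ≤ p`, `p` non-split, `ord_p ∏ c_ℓ ≤ 1`,
  `Ш(E)[p] = 0` ⟹ `MissingUpperBoundAt W p`», CONDITIONAL on the nine facts (Stein–Wuthrich 6.1 ×2, Kato 12.4, modularity, Kato §17.13 V′ ∕ VI′ ∕ XI′,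
  Mazur Cor. 4.1, GZK).  It contains rev 8's SECTOR′ (no split multiplicative prime) and ADDS the depth-one Tamagawa pairs; at `N < 5·10⁵` these are
  ALL SEVEN non-split non-unit pairs of the census (`52345c1` `ℓ = 29`, `74060f1` `ℓ = 7`, `86640dt1` `ℓ = 3`, `115320u1` `ℓ = 3`, `152280q1` `ℓ = 47`,
  `230640bz1` `ℓ = 3`, `346680j1` `ℓ = 107`: one split multiplicative `ℓ` with `v_ℓ(Δ) = 5`, `ord₅ (L/Ω) = 1`, `5 ∤ #Ш_an`; tree table
  `X11aPrintCertificates/RecordsLeafNonSurjN500000Part1–2.lean`); `padicValRat_shaAn_nonneg_of_shallowTamagawa` is its `Ш`-free arithmetic content.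
* §3 the open part of U5 RE-CUT INTO THREE CORES (each U5 verbatim on a sub-locus):
    C_exc = «X11a, `¬ Surj`, `5 ≤ p`, `p` SPLIT multiplicative ⟹ `MissingUpperBoundAt W p`»                    (EXCEPTIONAL ZERO; 23 census pairs @5),
    C_exp = «…, `p` non-split, `Ш(E)[p] ≠ 0`, `ord_p (L(E,1)/Ω_E) ≠ 0` ⟹ …»                                     (EXPONENT of `Ш`; 0 pairs `N < 5·10⁵`, the 15
                                                                                                                  twist pairs of `R2-CENSUS-cruxlead-g2.md`),
    C_tam = «…, `p` non-split, `ord_p ∏ c_ℓ ≥ 2`, `Ш(E)[p] = 0`, `ord_p (L(E,1)/Ω_E) ≠ 0` ⟹ …»                 (DEEP TAMAGAWA: «`p² ∣ ∏ c ⟹ p² ∣ L(E,1)/Ω_E`»,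
                                                                                                                  CENSUS-EMPTY at `N < 5·10⁵`),
  with the fact-free glue to the UNFOLDED crux statement `missingUpperBoundAt_of_unitSector_of_shallow_of_threeCores` (UNIT → SHALLOW → C_exc → C_exp →
  C_tam; the BY-NAME twin lives in the sequel), the comparison `threeCores_of_coreResiduals` (rev 9's cores imply the three cores FACT-FREE: C_exc ⊂ R₁′♭,
  C_exp ⊂ R′♭ ∪ R₁′♭, C_tam ⊂ R₁′♭ since `p ∣ ∏ c` forces a split multiplicative prime for `p ≥ 5`), and «rung of line finemu5 ⟹ the three cores»
  (`threeCores_of_muAnHardFive_of_nineFacts`, eight facts + Greenberg–Stevens).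

HONEST FRAMING.  §2 is BSD-quotient bookkeeping over p674376's divisibility, not a new Euler-system bound; it bounds no non-trivial `Ш` (its
hypothesis is `Ш(E)[p] = 0`).  The three cores are U5 VERBATIM on sub-loci and stay open research — C_exp faces the barrier
`EulerSystemBigImageAtSmallImage` (an exponent-`≥ 1` bound at mod-`p` image `N(C_s)` ∕ `5S4`), C_exc the exceptional zero at small image (the cell's
Kobayashi ∕ Greenberg–Stevens door is vacuous there, ruling R4-1), C_tam a multiplicity-one ∕ level-lowering congruence modulo `p²` that is not in print;
class-wide all three follow from Greenberg's analytic `μ = 0` on the hard locus (rung `Theorems.X11aNonSurjMuAnHardFive`).  The leaf `ClassX11a` is not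
closed; no statement of the summit is proved; BSD is not proved by any of this.  «beyond-print theorem: NO».

References: [MazurTateTeitelbaum1986] §I.10, §I.14; [Kato2004Asterisque] Thm. 12.4 (p. 221), §17.13 (pp. 279–280); [SteinWuthrich2013] Thm. 6.1
(p. 20); [Mazur1978] Cor. 4.1; [Mazur1977] Ch. III §5 (p. 157); [Wuthrich2014] Thm. 1 and Cor. 7 (doi:10.4171/dm/450); [SilvermanATAEC1994]
Cor. IV.9.2 (d) and Table 4.1; [Miller2011LMS] Def. 1.1 (arXiv:1010.2431 p. 3); [GreenbergLNM1716] §1 Conj. 1.11 (p. 62).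
-/

-- justified: the file namespace `Summit.BirchSwinnertonDyer.BirchSwinnertonDyer.Theorems.GL1Cartan` repeats the sub-problem segment by the D-0017 layout
set_option linter.dupNamespace false
set_option autoImplicit false

noncomputable section

open scoped Classical NumberField MatrixGroups ModularForm

open CongruenceSubgroup WeierstrassCurve
  Literature.NumberTheory.EllipticCurves
  Literature.NumberTheory.EllipticCurves.ModularForms
  Literature.NumberTheory.EllipticCurves.Rank1Residual
  Literature.NumberTheory.EllipticCurves.Rank1Residual.Typed
  Literature.NumberTheory.EllipticCurves.SteinWuthrich2013
  Literature.NumberTheory.EllipticCurves.Kato2004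
  Literature.NumberTheory.EllipticCurves.Wuthrich2014
  Summit.BirchSwinnertonDyer.Rank1Residual
  Summit.BirchSwinnertonDyer.Rank1Residual.X11b

namespace Summit.BirchSwinnertonDyer.BirchSwinnertonDyer.Theorems.GL1Cartan

/-! ## §1 The `p`-adic valuation of the analytic order on X11a -/

/-- **`ord_p #Ш_an = ord_p (L(E,1)/Ω_E) − ord_p ∏ c_ℓ` on X11a (CONDITIONAL on GZK, modularity, Mazur Cor. 4.1).**  For minimal `E/ℚ` in class X11a
at `p ≥ 5` (analytic rank `0`, `E[p]` irreducible): `#Ш_an = (L/Ω)·#E(ℚ)²/∏ c` with `p ∤ #E(ℚ)` (Cauchy + Mazur III §5), so the valuation of the analytic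
order is that of `L(E,1)/Ω_E` minus that of the Tamagawa product (no restriction on the split multiplicative primes; generalises
`padicValRat_shaAn_eq_padicValRat_LOne_div`). [cite: SilvermanATAEC1994, Cor. IV.9.2 (d) and Table 4.1] [cite: Mazur1977, Ch. III §5 (p. 157)]
[cite: Miller2011LMS, Def. 1.1 (arXiv:1010.2431 p. 3)] -/
theorem padicValRat_shaAn_eq_sub_tamagawa (hGZK : rank_eq_analyticRank_of_analyticRank_le_one)
    (hnf : exists_isNewformOf) (hMz : mazur_not_dvd_maninConstant_of_odd)
    {W : WeierstrassCurve ℚ} [W.IsElliptic] [W.IsGloballyMinimal] {p : ℕ} [Fact p.Prime]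
    (hX : ClassX11a W p) (hp5 : 5 ≤ p)
    {q t : ℚ} (hq : shaAn W = (q : ℂ)) (ht : W.entireLFunction 1 / (W.realPeriodRat : ℂ) = (t : ℂ)) :
    padicValRat p q = padicValRat p t - padicValNat p W.tamagawaProduct := by
  obtain ⟨t', ht', ht0', -⟩ := hX.exists_LOne_div_realPeriod_eq_of_mazur hnf hMz hp5
  have htt : t = t' := by exact_mod_cast ht.symm.trans ht'
  subst htt
  have hL1 : W.entireLFunction 1 ≠ 0 := by
    intro h0
    apply ht0'
    have h : ((t : ℚ) : ℂ) = 0 := by rw [← ht, h0, zero_div]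
    exact_mod_cast h
  obtain ⟨-, hE, -, hsha⟩ := shaAn_eq_of_L_one_div_eq hGZK W hL1 ht
  haveI := hE
  have hqq : q = t * (Nat.card W.toAffine.Point : ℚ) ^ 2 / (W.tamagawaProduct : ℚ) := by
    exact_mod_cast hq.symm.trans hsha
  subst hqq
  -- `p ∤ #E(ℚ)`: irreducible `E[p]` (Cauchy + Mazur III §5)
  have hcardE : ¬ p ∣ Nat.card W.toAffine.Point := fun hdvd =>
    not_exists_addOrderOf_eq_of_hasIrreducibleModPGaloisRep W hX.irr
      (exists_prime_addOrderOf_dvd_card' (G := W.toAffine.Point) p hdvd)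
  have hcard0 : (Nat.card W.toAffine.Point : ℚ) ≠ 0 := by
    exact_mod_cast (Nat.card_pos (α := W.toAffine.Point)).ne'
  have htam0 : (W.tamagawaProduct : ℚ) ≠ 0 := by
    exact_mod_cast (W.tamagawaProduct_pos_holds : 0 < W.tamagawaProduct).ne'
  have hcardv : padicValRat p (Nat.card W.toAffine.Point : ℚ) = 0 := by
    rw [padicValRat.of_nat, padicValNat.eq_zero_of_not_dvd hcardE, Nat.cast_zero]
  rw [padicValRat.div (mul_ne_zero ht0' (pow_ne_zero 2 hcard0)) htam0,
    padicValRat.mul ht0' (pow_ne_zero 2 hcard0), padicValRat.pow, hcardv, padicValRat.of_nat]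
  ring

/-! ## §2 The SHALLOW sector of U5 (modulo the nine facts) -/

/-- **The SHALLOW sector, per pair (CONDITIONAL on nine named print facts).**  For minimal `E/ℚ` in class X11a with `ρ̄_{E,p}` not surjective, `5 ≤ p`,
`p` NON-split multiplicative, `ord_p ∏ c_ℓ ≤ 1` and `Ш(E/ℚ)[p] = 0`: `ord_p #Ш ≤ ord_p #Ш_an` (`MissingUpperBoundAt W p`).  Proof: `ord_p #Ш_an =
ord_p (L/Ω) − ord_p ∏ c` (§1); if `p ∤ ∏ c` this is `ord_p (L/Ω) ≥ 0` (modularity + Mazur); if `p ∣ ∏ c` then a split multiplicative `ℓ` with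
`p ∣ v_ℓ(Δ_min)` exists (`X11b.dvd_tamagawaProduct_iff_exists_split`, `p ≥ 5`), so `ord_p (L/Ω) ≥ 1` by the Tamagawa divisibility
`one_le_padicValRat_LOne_div_of_exists_split` (eight facts + GZK) and `ord_p #Ш_an ≥ 1 − 1 = 0`; the door `ClassX11a.missingUpperBoundAt_of_noPTorsion`
concludes. [cite: SilvermanATAEC1994, Cor. IV.9.2 (d) and Table 4.1] [cite: Kato2004Asterisque, §17.13 (pp. 279–280)] [cite: Miller2011LMS, Def. 1.1] -/
theorem missingUpperBoundAt_of_noPTorsion_of_shallowTamagawa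
    (hJs : thm61_splitMultiplicative) (hJn : thm61_nonsplitMultiplicative)
    (h12 : Kato2004.thm12_4) (hnf : exists_isNewformOf)
    (hns' : Kato2004.exists_multDivisibilityInputs_nonsplit_contra)
    (hsp' : Kato2004.exists_multDivisibilityInputs_split_contra)
    (hfine' : Kato2004.exists_multDivisibilityInputs_fine_contra) (hMz : mazur_not_dvd_maninConstant_of_odd)
    (hGZK : rank_eq_analyticRank_of_analyticRank_le_one)
    {W : WeierstrassCurve ℚ} [W.IsElliptic] [W.IsGloballyMinimal] {p : ℕ} [Fact p.Prime]
    (hX : ClassX11a W p) (hns : ¬ Surj W p) (hp5 : 5 ≤ p) (hnsp : ¬ W.HasSplitMultiplicativeReductionAtPrime p)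
    (htam : padicValNat p W.tamagawaProduct ≤ 1) (hSha : ∀ x : W.sha, (p : ℤ) • x = 0 → x = 0) :
    MissingUpperBoundAt W p := by
  have hp : p.Prime := Fact.out
  obtain ⟨t, ht, ht0, hv0⟩ := hX.exists_LOne_div_realPeriod_eq_of_mazur hnf hMz hp5
  have hL1 : W.entireLFunction 1 ≠ 0 := by
    intro h0
    apply ht0
    have h : ((t : ℚ) : ℂ) = 0 := by rw [← ht, h0, zero_div]
    exact_mod_cast h
  obtain ⟨-, -, -, hsha⟩ := shaAn_eq_of_L_one_div_eq hGZK W hL1 ht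
  have hvq := padicValRat_shaAn_eq_sub_tamagawa hGZK hnf hMz hX hp5 hsha ht
  refine hX.missingUpperBoundAt_of_noPTorsion hGZK hsha ?_ hSha
  rw [hvq]
  by_cases hdvd : p ∣ W.tamagawaProduct
  · -- depth one: a split multiplicative `ℓ` exists, so `ord_p (L/Ω) ≥ 1`
    obtain ⟨ℓ, hℓ, hsplit, -⟩ := (X11b.dvd_tamagawaProduct_iff_exists_split W hp hp5).mp hdvd
    have h1 : 1 ≤ padicValRat p t :=
      one_le_padicValRat_LOne_div_of_exists_split hJs hJn h12 hnf hns' hsp' hfine' hMz hGZK hX hns hp5 hnsp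
        ⟨ℓ, hℓ, hsplit⟩ ht
    have h2 : (padicValNat p W.tamagawaProduct : ℤ) ≤ 1 := by exact_mod_cast htam
    linarith
  · -- depth zero: `L/Ω` is `p`-integral
    rw [padicValNat.eq_zero_of_not_dvd hdvd, Nat.cast_zero, sub_zero]
    exact hv0

/-- **The SHALLOW sector of U5, class-wide (CONDITIONAL on the nine named print facts).**  «X11a, `¬ Surj`, `5 ≤ p`, `p` non-split multiplicative,
`ord_p ∏ c_ℓ ≤ 1`, `Ш(E)[p] = 0` ⟹ `MissingUpperBoundAt W p`» — rev 8's SECTOR′ (no split multiplicative prime) together with the depth-one Tamagawa pairs;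
census at `N < 5·10⁵`: the seven non-split non-unit pairs, all of depth one with `5 ∤ #Ш_an`. [cite: SilvermanATAEC1994, Cor. IV.9.2 (d) and Table 4.1]
[cite: Kato2004Asterisque, §17.13 (pp. 279–280)] [cite: Miller2011LMS, Def. 1.1 (arXiv:1010.2431 p. 3)] -/
theorem upperNonSurjFive_on_shallowSector_of_nineFacts
    (hJs : thm61_splitMultiplicative) (hJn : thm61_nonsplitMultiplicative)
    (h12 : Kato2004.thm12_4) (hnf : exists_isNewformOf)
    (hns' : Kato2004.exists_multDivisibilityInputs_nonsplit_contra)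
    (hsp' : Kato2004.exists_multDivisibilityInputs_split_contra)
    (hfine' : Kato2004.exists_multDivisibilityInputs_fine_contra) (hMz : mazur_not_dvd_maninConstant_of_odd)
    (hGZK : rank_eq_analyticRank_of_analyticRank_le_one) :
    ∀ (W : WeierstrassCurve ℚ) [W.IsElliptic] [W.IsGloballyMinimal] (p : ℕ) [Fact p.Prime],
      ClassX11a W p → ¬ Surj W p → 5 ≤ p → ¬ W.HasSplitMultiplicativeReductionAtPrime p →
      padicValNat p W.tamagawaProduct ≤ 1 → (∀ x : W.sha, (p : ℤ) • x = 0 → x = 0) → MissingUpperBoundAt W p :=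
  fun _ _ _ _ _ hX hns hp5 hnsp htam hSha =>
    missingUpperBoundAt_of_noPTorsion_of_shallowTamagawa hJs hJn h12 hnf hns' hsp' hfine' hMz hGZK hX hns hp5 hnsp htam hSha

/-- **BSD-consistency at depth `≤ 1` (CONDITIONAL on the nine facts): `ord_p #Ш_an ≥ 0` at a non-split `p` with `ord_p ∏ c_ℓ ≤ 1`.**  Arithmetic content of
the shallow sector with no hypothesis on `Ш`: the Tamagawa `p` of a depth-one pair is paid by the `L`-value. [cite: SilvermanATAEC1994, Cor. IV.9.2 (d)]
[cite: Kato2004Asterisque, §17.13 (pp. 279–280)] -/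
theorem padicValRat_shaAn_nonneg_of_shallowTamagawa
    (hJs : thm61_splitMultiplicative) (hJn : thm61_nonsplitMultiplicative)
    (h12 : Kato2004.thm12_4) (hnf : exists_isNewformOf)
    (hns' : Kato2004.exists_multDivisibilityInputs_nonsplit_contra)
    (hsp' : Kato2004.exists_multDivisibilityInputs_split_contra)
    (hfine' : Kato2004.exists_multDivisibilityInputs_fine_contra) (hMz : mazur_not_dvd_maninConstant_of_odd)
    (hGZK : rank_eq_analyticRank_of_analyticRank_le_one)
    {W : WeierstrassCurve ℚ} [W.IsElliptic] [W.IsGloballyMinimal] {p : ℕ} [Fact p.Prime]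
    (hX : ClassX11a W p) (hns : ¬ Surj W p) (hp5 : 5 ≤ p) (hnsp : ¬ W.HasSplitMultiplicativeReductionAtPrime p)
    (htam : padicValNat p W.tamagawaProduct ≤ 1) {q : ℚ} (hq : shaAn W = (q : ℂ)) : 0 ≤ padicValRat p q := by
  have hp : p.Prime := Fact.out
  obtain ⟨t, ht, -, hv0⟩ := hX.exists_LOne_div_realPeriod_eq_of_mazur hnf hMz hp5
  rw [padicValRat_shaAn_eq_sub_tamagawa hGZK hnf hMz hX hp5 hq ht]
  by_cases hdvd : p ∣ W.tamagawaProduct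
  · obtain ⟨ℓ, hℓ, hsplit, -⟩ := (X11b.dvd_tamagawaProduct_iff_exists_split W hp hp5).mp hdvd
    have h1 : 1 ≤ padicValRat p t :=
      one_le_padicValRat_LOne_div_of_exists_split hJs hJn h12 hnf hns' hsp' hfine' hMz hGZK hX hns hp5 hnsp
        ⟨ℓ, hℓ, hsplit⟩ ht
    have h2 : (padicValNat p W.tamagawaProduct : ℤ) ≤ 1 := by exact_mod_cast htam
    linarith
  · rw [padicValNat.eq_zero_of_not_dvd hdvd, Nat.cast_zero, sub_zero]
    exact hv0

/-! ## §3 The open part of U5 re-cut into three cores: glue to the unfolded crux statement and comparisons (route-file-free) -/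

/-- **Glue (fact-free; rev 10 of the record): UNIT → SHALLOW → C_exc → C_exp → C_tam ⟹ the UNFOLDED statement of U5** («X11a, `¬ Surj`, `5 ≤ p` ⟹
`MissingUpperBoundAt W p`»; the BY-NAME twin is `upperNonSurjFive_of_unitSector_of_shallow_of_threeCores` in the sequel).  Case split: «`p` split
multiplicative» (C_exc); else «`L(E,1)/Ω_E` a `p`-adic unit» (UNIT); else «`Ш(E)[p] ≠ 0`» (C_exp); else «`ord_p ∏ c ≤ 1`» (SHALLOW) or «`≥ 2`» (C_tam).
[cite: Miller2011LMS, Def. 1.1 (arXiv:1010.2431 p. 3)] [cite: SilvermanATAEC1994, Cor. IV.9.2 (d)] -/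
theorem missingUpperBoundAt_of_unitSector_of_shallow_of_threeCores
    (hU : ∀ (W : WeierstrassCurve ℚ) [W.IsElliptic] [W.IsGloballyMinimal] (p : ℕ) [Fact p.Prime],
      ClassX11a W p → ¬ Surj W p → 5 ≤ p → ¬ W.HasSplitMultiplicativeReductionAtPrime p →
      (∃ t : ℚ, W.entireLFunction 1 / (W.realPeriodRat : ℂ) = (t : ℂ) ∧ padicValRat p t = 0) →
      MissingUpperBoundAt W p)
    (hS : ∀ (W : WeierstrassCurve ℚ) [W.IsElliptic] [W.IsGloballyMinimal] (p : ℕ) [Fact p.Prime],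
      ClassX11a W p → ¬ Surj W p → 5 ≤ p → ¬ W.HasSplitMultiplicativeReductionAtPrime p →
      padicValNat p W.tamagawaProduct ≤ 1 → (∀ x : W.sha, (p : ℤ) • x = 0 → x = 0) → MissingUpperBoundAt W p)
    (hCe : ∀ (W : WeierstrassCurve ℚ) [W.IsElliptic] [W.IsGloballyMinimal] (p : ℕ) [Fact p.Prime],
      ClassX11a W p → ¬ Surj W p → 5 ≤ p → W.HasSplitMultiplicativeReductionAtPrime p → MissingUpperBoundAt W p)
    (hCx : ∀ (W : WeierstrassCurve ℚ) [W.IsElliptic] [W.IsGloballyMinimal] (p : ℕ) [Fact p.Prime],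
      ClassX11a W p → ¬ Surj W p → 5 ≤ p → ¬ W.HasSplitMultiplicativeReductionAtPrime p →
      (∃ x : W.sha, (p : ℤ) • x = 0 ∧ x ≠ 0) →
      (∀ t : ℚ, W.entireLFunction 1 / (W.realPeriodRat : ℂ) = (t : ℂ) → padicValRat p t ≠ 0) →
      MissingUpperBoundAt W p)
    (hCt : ∀ (W : WeierstrassCurve ℚ) [W.IsElliptic] [W.IsGloballyMinimal] (p : ℕ) [Fact p.Prime],
      ClassX11a W p → ¬ Surj W p → 5 ≤ p → ¬ W.HasSplitMultiplicativeReductionAtPrime p →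
      2 ≤ padicValNat p W.tamagawaProduct → (∀ x : W.sha, (p : ℤ) • x = 0 → x = 0) →
      (∀ t : ℚ, W.entireLFunction 1 / (W.realPeriodRat : ℂ) = (t : ℂ) → padicValRat p t ≠ 0) →
      MissingUpperBoundAt W p) :
    ∀ (W : WeierstrassCurve ℚ) [W.IsElliptic] [W.IsGloballyMinimal] (p : ℕ) [Fact p.Prime],
      ClassX11a W p → ¬ Surj W p → 5 ≤ p → MissingUpperBoundAt W p := by
  intro W _ _ p _ hX hns hp5
  by_cases hsp : W.HasSplitMultiplicativeReductionAtPrime p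
  · exact hCe W p hX hns hp5 hsp
  by_cases hunit : ∃ t : ℚ, W.entireLFunction 1 / (W.realPeriodRat : ℂ) = (t : ℂ) ∧ padicValRat p t = 0
  · exact hU W p hX hns hp5 hsp hunit
  have hval : ∀ t : ℚ, W.entireLFunction 1 / (W.realPeriodRat : ℂ) = (t : ℂ) → padicValRat p t ≠ 0 :=
    fun t ht h0 => hunit ⟨t, ht, h0⟩
  by_cases hSha : ∀ x : W.sha, (p : ℤ) • x = 0 → x = 0
  · by_cases htam : padicValNat p W.tamagawaProduct ≤ 1
    · exact hS W p hX hns hp5 hsp htam hSha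
    · exact hCt W p hX hns hp5 hsp (by omega) hSha hval
  · push Not at hSha
    exact hCx W p hX hns hp5 hsp hSha hval

/-- **Rev 9 ⇒ rev 10 (fact-free): the two non-unit cores R′♭ ∕ R₁′♭ of rev 9 imply the three cores C_exc ∕ C_exp ∕ C_tam.**  C_exc ⊂ R₁′♭ (`ℓ = p` is a split
multiplicative prime; hard locus by its first clause); C_exp ⊂ R′♭ ∪ R₁′♭ (case «some split multiplicative prime», hard locus by its second clause); C_tam ⊂ R₁′♭
(`p ∣ ∏ c` forces a split multiplicative prime with `p ∣ v_ℓ(Δ_min)` for `p ≥ 5`, `X11b.dvd_tamagawaProduct_iff_exists_split`).  So rev 10 asks NO MORE of the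
future than rev 9. [cite: SilvermanATAEC1994, Cor. IV.9.2 (d) and Table 4.1] [cite: Miller2011LMS, Def. 1.1] -/
theorem threeCores_of_coreResiduals
    (hC' : ∀ (W : WeierstrassCurve ℚ) [W.IsElliptic] [W.IsGloballyMinimal] (p : ℕ) [Fact p.Prime],
      ClassX11a W p → ¬ Surj W p → 5 ≤ p → (∀ (ℓ : ℕ) [Fact ℓ.Prime], ¬ W.HasSplitMultiplicativeReductionAtPrime ℓ) →
      (∃ x : W.sha, (p : ℤ) • x = 0 ∧ x ≠ 0) →
      (∀ t : ℚ, W.entireLFunction 1 / (W.realPeriodRat : ℂ) = (t : ℂ) → padicValRat p t ≠ 0) →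
      MissingUpperBoundAt W p)
    (hC₁' : ∀ (W : WeierstrassCurve ℚ) [W.IsElliptic] [W.IsGloballyMinimal] (p : ℕ) [Fact p.Prime],
      ClassX11a W p → ¬ Surj W p → 5 ≤ p →
      (∃ (ℓ : ℕ) (_ : Fact ℓ.Prime), W.HasSplitMultiplicativeReductionAtPrime ℓ) →
      (W.HasSplitMultiplicativeReductionAtPrime p ∨
        ∀ t : ℚ, W.entireLFunction 1 / (W.realPeriodRat : ℂ) = (t : ℂ) → padicValRat p t ≠ 0) →
      MissingUpperBoundAt W p) :
    (∀ (W : WeierstrassCurve ℚ) [W.IsElliptic] [W.IsGloballyMinimal] (p : ℕ) [Fact p.Prime],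
        ClassX11a W p → ¬ Surj W p → 5 ≤ p → W.HasSplitMultiplicativeReductionAtPrime p → MissingUpperBoundAt W p) ∧
      (∀ (W : WeierstrassCurve ℚ) [W.IsElliptic] [W.IsGloballyMinimal] (p : ℕ) [Fact p.Prime],
        ClassX11a W p → ¬ Surj W p → 5 ≤ p → ¬ W.HasSplitMultiplicativeReductionAtPrime p →
        (∃ x : W.sha, (p : ℤ) • x = 0 ∧ x ≠ 0) →
        (∀ t : ℚ, W.entireLFunction 1 / (W.realPeriodRat : ℂ) = (t : ℂ) → padicValRat p t ≠ 0) →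
        MissingUpperBoundAt W p) ∧
      (∀ (W : WeierstrassCurve ℚ) [W.IsElliptic] [W.IsGloballyMinimal] (p : ℕ) [Fact p.Prime],
        ClassX11a W p → ¬ Surj W p → 5 ≤ p → ¬ W.HasSplitMultiplicativeReductionAtPrime p →
        2 ≤ padicValNat p W.tamagawaProduct → (∀ x : W.sha, (p : ℤ) • x = 0 → x = 0) →
        (∀ t : ℚ, W.entireLFunction 1 / (W.realPeriodRat : ℂ) = (t : ℂ) → padicValRat p t ≠ 0) →
        MissingUpperBoundAt W p) := by
  refine ⟨fun W _ _ p _ hX hns hp5 hsp => hC₁' W p hX hns hp5 ⟨p, inferInstance, hsp⟩ (Or.inl hsp),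
    fun W _ _ p _ hX hns hp5 _ hSha hval => ?_, fun W _ _ p _ hX hns hp5 _ htam _ hval => ?_⟩
  · by_cases hsm : ∃ (ℓ : ℕ) (_ : Fact ℓ.Prime), W.HasSplitMultiplicativeReductionAtPrime ℓ
    · exact hC₁' W p hX hns hp5 hsm (Or.inr hval)
    · exact hC' W p hX hns hp5 (fun ℓ hℓ h => hsm ⟨ℓ, hℓ, h⟩) hSha hval
  · have hp : p.Prime := Fact.out
    have hdvd : p ∣ W.tamagawaProduct := dvd_of_one_le_padicValNat (by omega)
    obtain ⟨ℓ, hℓ, hsplit, -⟩ := (X11b.dvd_tamagawaProduct_iff_exists_split W hp hp5).mp hdvd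
    exact hC₁' W p hX hns hp5 ⟨ℓ, hℓ, hsplit⟩ (Or.inr hval)

/-- **Rung of line «finemu5» ⇒ the three cores (CONDITIONAL on the eight facts + Greenberg–Stevens).**  Greenberg's analytic `μ = 0` on the hard locus
(`Theorems.X11aNonSurjMuAnHardFive`) serves each core through the μ-certificate door `ClassX11a.missingUpperBoundAt_of_not_surj_of_muCert_contra` (each core lies
on the hard locus: C_exc by «`p` split», C_exp ∕ C_tam by «non-unit value»): the record line asks no more of the future than the μ-line, and strictly less
(no `μ`-statement where `Ш(E)[p] = 0` and `ord_p ∏ c ≤ 1`). [cite: GreenbergLNM1716, §1 Conj. 1.11 (p. 62)] [cite: Kato2004Asterisque, §17.13 (pp. 279–280)] -/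
theorem threeCores_of_muAnHardFive_of_nineFacts (hH : X11aNonSurjMuAnHardFive)
    (hJs : thm61_splitMultiplicative) (hJn : thm61_nonsplitMultiplicative)
    (hGS : ∀ (W : WeierstrassCurve ℚ) [W.IsElliptic] [W.IsGloballyMinimal] (p : ℕ) [Fact p.Prime],
      greenberg_stevens (W := W) (p := p))
    (h12 : Kato2004.thm12_4) (hnf : exists_isNewformOf)
    (hns' : Kato2004.exists_multDivisibilityInputs_nonsplit_contra)
    (hsp' : Kato2004.exists_multDivisibilityInputs_split_contra)
    (hfine' : Kato2004.exists_multDivisibilityInputs_fine_contra) (hMz : mazur_not_dvd_maninConstant_of_odd) :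
    (∀ (W : WeierstrassCurve ℚ) [W.IsElliptic] [W.IsGloballyMinimal] (p : ℕ) [Fact p.Prime],
        ClassX11a W p → ¬ Surj W p → 5 ≤ p → W.HasSplitMultiplicativeReductionAtPrime p → MissingUpperBoundAt W p) ∧
      (∀ (W : WeierstrassCurve ℚ) [W.IsElliptic] [W.IsGloballyMinimal] (p : ℕ) [Fact p.Prime],
        ClassX11a W p → ¬ Surj W p → 5 ≤ p → ¬ W.HasSplitMultiplicativeReductionAtPrime p →
        (∃ x : W.sha, (p : ℤ) • x = 0 ∧ x ≠ 0) →
        (∀ t : ℚ, W.entireLFunction 1 / (W.realPeriodRat : ℂ) = (t : ℂ) → padicValRat p t ≠ 0) →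
        MissingUpperBoundAt W p) ∧
      (∀ (W : WeierstrassCurve ℚ) [W.IsElliptic] [W.IsGloballyMinimal] (p : ℕ) [Fact p.Prime],
        ClassX11a W p → ¬ Surj W p → 5 ≤ p → ¬ W.HasSplitMultiplicativeReductionAtPrime p →
        2 ≤ padicValNat p W.tamagawaProduct → (∀ x : W.sha, (p : ℤ) • x = 0 → x = 0) →
        (∀ t : ℚ, W.entireLFunction 1 / (W.realPeriodRat : ℂ) = (t : ℂ) → padicValRat p t ≠ 0) →
        MissingUpperBoundAt W p) := by
  refine ⟨fun W _ _ p _ hX hns hp5 hsp => ?_, fun W _ _ p _ hX hns hp5 _ _ hval => ?_,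
    fun W _ _ p _ hX hns hp5 _ _ _ hval => ?_⟩
  · exact hX.missingUpperBoundAt_of_not_surj_of_muCert_contra hJs hJn h12 hnf hns' hsp' hfine' hMz W p (fun _ => hGS W p) hns
      (fun f hf ϖ hϖ a L hsa hna hL => hH W p hX hns hp5 (Or.inl hsp) f hf ϖ hϖ a L hsa hna hL)
  · exact hX.missingUpperBoundAt_of_not_surj_of_muCert_contra hJs hJn h12 hnf hns' hsp' hfine' hMz W p (fun _ => hGS W p) hns
      (fun f hf ϖ hϖ a L hsa hna hL => hH W p hX hns hp5 (Or.inr hval) f hf ϖ hϖ a L hsa hna hL)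
  · exact hX.missingUpperBoundAt_of_not_surj_of_muCert_contra hJs hJn h12 hnf hns' hsp' hfine' hMz W p (fun _ => hGS W p) hns
      (fun f hf ϖ hϖ a L hsa hna hL => hH W p hX hns hp5 (Or.inr hval) f hf ϖ hϖ a L hsa hna hL)

end Summit.BirchSwinnertonDyer.BirchSwinnertonDyer.Theorems.GL1Cartan

end
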